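import Summits.BirchSwinnertonDyer.BirchSwinnertonDyer.Theorems.AdditiveKolyvaginRoadLevelSystemsRigidityCore
import Summits.BirchSwinnertonDyer.BirchSwinnertonDyer.Theorems.AdditiveKolyvaginRoadLevelSystemsOfFirstFloor
import Summits.BirchSwinnertonDyer.BirchSwinnertonDyer.Theorems.AdditiveKolyvaginRoadLevelSystemsBottomOfRaise
import HarnessLib

/-!
# Route `AdditiveKolyvaginRoad`, crux `LevelKolyvaginSystemsAdditive` (item stmt-BirchSwinnertonDyer-21396, KS′):
# RIGIDITY of level-indexed classes in `H¹(K, E[p])` along Howard's core graph — the carrier's instance, and the supply of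
# odd core levels from rank lowering (A1)
# (cell `pub/bsd-wall`, width seat `bsd-wall-akr-p2x-w2` g2; `--supports stmt-BirchSwinnertonDyer-21396`, helper; part 2 of 3,
# after `…LevelSystemsRigidityCore` (abstract edge lemmas and propagation); part 3 `…LevelSystemsOfIgnition` assembles)

WHAT. The abstract rigidity of part 1 instantiated for the route's objects: ambient `Vp W K p = H¹(K, E[p])`, canonical
spaces `SelQP W K p c n μ` (`Theorems/AdditiveKolyvaginRoadLevelDefs.lean`), «locally trivial above the admissible prime `q`» =
«in `torsionLocalKer` at every place `v ∋ q`» (the currency of the carrier's `baseLocusQP`, Def. 8.3, and of w2 ∕ w3's law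
binders), classes `κ n` indexed by levels `n : Finset (AdmQ W K p)` — meant: the conductor-one classes `κ₀ ∅ n` of a
would-be `LevelKolyvaginSystemP`, or `κ₀ m n` at a fixed conductor.
* §2 bookkeeping: `mem_selQP_of_mem_selQP_insert_of_forall_mem_torsionLocalKer` («out»; «in» is akr-p2x g0's
  `mem_selQP_insert_of_forall_mem_torsionLocalKer`) — together Howard's `S_{n∪q} ∩ ker loc_q = S_n ∩ ker loc_q` (Lemma 2.3.3);
  `not_forall_mem_torsionLocalKer_iff`; `forall_mem_torsionLocalKer_iff_of_congr` (w3's placewise (SRL) ⟹ prime-wise).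
* §2a CONGRUENCE form: `ne_zero_iff_of_coreRung` (ONE rung `n — n ∪ {q₁,q₂}` through an odd CORE level:
  `κ(n) ≠ 0 ⟺ κ(n ∪ {q₁,q₂}) ≠ 0`; the down-direction is new, the up-direction's first step is w3's
  `not_mem_torsionLocalKer_of_ne_zero_of_selQP_insert_eq_bot`) and `ne_zero_of_coreRungs` (propagation from ONE non-zero class
  along `Relation.EqvGen` of the rung relation).
* §2b BIPARTITE form: `ne_zero_of_coreEdges` — with odd-level value predicates `Λ` and the laws (A), (B) two-sided, ONE seed
  (a non-zero class at an even level OR a unit value at an odd level) gives `κ ≠ 0` at every even level of its component of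
  Howard's core graph (edges `a — a ∪ {q}`, the odd end core).
* §4 SUPPLY: `exists_oddCore_above_of_rankOne` — (A1) in binder form ⟹ above every even level of canonical rank one there is
  an odd CORE level `n ∪ {q₁}` (so rungs `n — n ∪ {q₁,q₂}` for EVERY further `q₂`); `…_at_frame` — the same at a ♯ additive
  frame with (A1) DISCHARGED by the landed `stub_rankLoweringAdditive` (akr-p1 g2). First brick of connectivity (Howard
  Lemma 2.4.9); the rest (Lemma 2.4.10 ∕ Prop. 2.4.11) is NOT here.

HONEST FRAMING: theorems only; 0 definitions, 0 named facts, 0 `sorry`; laws ∕ congruences ∕ memberships are HYPOTHESES;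
closes nothing. In print for `p ∤ N` (Howard 2006 §2 with W. Zhang 2014 §§4–9); at `p² ∣ N` the classes at the 2-prime
levels and the laws' multiplicity-one input are the crux's open content, untouched. BSD is not proved by any of this.

References: [cite: Howard2006Bipartite, Lemma 2.3.3, Cor. 2.3.5, Lemma 2.4.9, Cor. 2.4.12, Thm. 2.5.1] [cite: WZhang2014,
Thm. 4.3, (4.8), Prop. 5.4, Thm. 7.2, Lemma 7.3, Def. 8.3, §9] [cite: BertoliniDarmon2005, Thm. 3.2, Thm. 4.1, Thm. 4.2].
-/

-- single-conjunct summit: `Summit.BirchSwinnertonDyer.BirchSwinnertonDyer.…` repeats the name by design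
set_option linter.dupNamespace false

noncomputable section

open scoped Classical

/-! ## §2 The carrier: local triviality above an admissible prime; edges, rungs and propagation for level-indexed classes -/

namespace Summit.BirchSwinnertonDyer.BirchSwinnertonDyer.Theorems.AdditiveKoly

open WeierstrassCurve NumberField IsDedekindDomain
  Literature.NumberTheory.EllipticCurves Literature.NumberTheory.EllipticCurves.ModularForms
  Literature.NumberTheory.EllipticCurves.Rank1Residual Literature.NumberTheory.GaloisRepresentations Module
  Summit.BirchSwinnertonDyer.Rank1Residual.X11b.Three.Koly

variable (W : WeierstrassCurve ℚ) (K : Type) [Field K] [NumberField K] (p : ℕ) [W.IsGloballyMinimal]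
  (c : K ≃ₐ[ℚ] K) [Module (ZMod p) (Vp W K p)]

/-- **A level-`(n ∪ {q})` class locally TRIVIAL above `q` is a level-`n` class** (of the same sign): the toric condition
above `q` is dropped, E's Kummer condition above `q` holds by local triviality (`torsionLocalKer ≤ selmerLocalKer`), every
other condition is common to both levels. Companion («out») of akr-p2x g0's «in» `mem_selQP_insert_of_forall_mem_torsionLocalKer`;
together: Howard's `S_{n∪q} ∩ ker loc_q = S_n ∩ ker loc_q` (Lemma 2.3.3). [cite: Howard2006Bipartite, Lemma 2.3.3]
[cite: WZhang2014, §5 (Sel_{𝔭_n}), §9 (9.3)] -/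
theorem mem_selQP_of_mem_selQP_insert_of_forall_mem_torsionLocalKer {n : Finset (AdmQ W K p)} {q : AdmQ W K p}
    {μ : Bool} {z : Vp W K p} (hz : z ∈ SelQP W K p c (insert q n) μ)
    (hloc : ∀ v : HeightOneSpectrum (𝓞 K), ((q : ℕ) : 𝓞 K) ∈ v.asIdeal →
      z ∈ (W.baseChange K).torsionLocalKer (v.adicCompletion K) ((p ^ 1 : ℕ) : ℤ)) :
    z ∈ SelQP W K p c n μ := by
  obtain ⟨hsgn, hinf, hfin, htor⟩ := (mem_selQP_iff W K p c (insert q n) μ z).mp hz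
  refine (mem_selQP_iff W K p c n μ z).mpr
    ⟨hsgn, hinf, fun v hv ↦ ?_, fun q' hq' v hv ↦ htor q' (Finset.mem_insert_of_mem hq') v hv⟩
  by_cases hqv : ((q : ℕ) : 𝓞 K) ∈ v.asIdeal
  · exact (W.baseChange K).torsionLocalKer_le_selmerLocalKer (v.adicCompletion K) _ (hloc v hqv)
  · refine hfin v fun q' hq' ↦ ?_
    rcases Finset.mem_insert.mp hq' with rfl | hq'
    · exact hqv
    · exact hv q' hq'

omit [Module (ZMod p) (Vp W K p)] in
/-- **Local triviality above `q`, negated**: a class is NOT locally trivial above every place of `q` iff it is detected at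
SOME place above `q` (for an inert admissible `q` there is exactly one). [folklore] -/
theorem not_forall_mem_torsionLocalKer_iff {q : AdmQ W K p} {y : Vp W K p} :
    (¬ ∀ v : HeightOneSpectrum (𝓞 K), ((q : ℕ) : 𝓞 K) ∈ v.asIdeal →
        y ∈ (W.baseChange K).torsionLocalKer (v.adicCompletion K) ((p ^ 1 : ℕ) : ℤ)) ↔
      ∃ v : HeightOneSpectrum (𝓞 K), ((q : ℕ) : 𝓞 K) ∈ v.asIdeal ∧
        y ∉ (W.baseChange K).torsionLocalKer (v.adicCompletion K) ((p ^ 1 : ℕ) : ℤ) := by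
  simp only [not_forall, exists_prop]

omit [Module (ZMod p) (Vp W K p)] in
/-- **The congruence of two localisations, place-free form**: if «`y` locally trivial at `v₁ ∣ q₁` ⟺ `y''` locally trivial at
`v₂ ∣ q₂`» for all places `v₁ ∣ q₁`, `v₂ ∣ q₂` (w3's (SRL) binder, W. Zhang Thm. 4.3), then «`y` locally trivial above `q₁`
⟺ `y''` locally trivial above `q₂`» (places above the primes `q₁`, `q₂` exist). [cite: WZhang2014, Thm. 4.3] -/
theorem forall_mem_torsionLocalKer_iff_of_congr {q₁ q₂ : AdmQ W K p} {y y'' : Vp W K p}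
    (h : ∀ (v₁ v₂ : HeightOneSpectrum (𝓞 K)), ((q₁ : ℕ) : 𝓞 K) ∈ v₁.asIdeal → ((q₂ : ℕ) : 𝓞 K) ∈ v₂.asIdeal →
      (y ∈ (W.baseChange K).torsionLocalKer (v₁.adicCompletion K) ((p ^ 1 : ℕ) : ℤ) ↔
        y'' ∈ (W.baseChange K).torsionLocalKer (v₂.adicCompletion K) ((p ^ 1 : ℕ) : ℤ))) :
    (∀ v₁ : HeightOneSpectrum (𝓞 K), ((q₁ : ℕ) : 𝓞 K) ∈ v₁.asIdeal →
        y ∈ (W.baseChange K).torsionLocalKer (v₁.adicCompletion K) ((p ^ 1 : ℕ) : ℤ)) ↔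
      (∀ v₂ : HeightOneSpectrum (𝓞 K), ((q₂ : ℕ) : 𝓞 K) ∈ v₂.asIdeal →
        y'' ∈ (W.baseChange K).torsionLocalKer (v₂.adicCompletion K) ((p ^ 1 : ℕ) : ℤ)) := by
  obtain ⟨w₁, hw₁⟩ :=
    Literature.NumberTheory.NumberFields.RingOfIntegers.exists_heightOneSpectrum_natCast_mem K q₁.2.1
  obtain ⟨w₂, hw₂⟩ :=
    Literature.NumberTheory.NumberFields.RingOfIntegers.exists_heightOneSpectrum_natCast_mem K q₂.2.1
  exact ⟨fun h₁ v₂ hv₂ ↦ (h w₁ v₂ hw₁ hv₂).mp (h₁ w₁ hw₁), fun h₂ v₁ hv₁ ↦ (h v₁ w₂ hv₁ hw₂).mpr (h₂ w₂ hw₂)⟩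

/-! ### §2a The congruence form (W. Zhang Thm 4.3): rungs -/

/-- **ONE RUNG for level-indexed classes in `H¹(K, E[p])`** (`κ n`, e.g. the conductor-one classes `κ₀ ∅ n` of a would-be
`LevelKolyvaginSystemP`): for an even-or-any level `n`, new admissible `q₁ ∉ n`, `q₂ ∉ n ∪ q₁`, GIVEN the congruence (SRL)
between `loc_{v₁} κ(n)` and `loc_{v₂} κ(n ∪ {q₁,q₂})`, the classes in their level spaces `Sel_n^μ`, `Sel_{n∪q₁∪q₂}^{μ''}`,
and the odd level CORE (`Sel_{n∪q₁}^+ = Sel_{n∪q₁}^- = 0`): `κ(n) ≠ 0 ⟺ κ(n ∪ {q₁, q₂}) ≠ 0`.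
[cite: WZhang2014, Thm. 4.3, Thm. 7.2, §9] [cite: Howard2006Bipartite, Cor. 2.3.5] -/
theorem ne_zero_iff_of_coreRung (κ : Finset (AdmQ W K p) → Vp W K p) {n : Finset (AdmQ W K p)} {q₁ q₂ : AdmQ W K p}
    (hq₁ : q₁ ∉ n) (hq₂ : q₂ ∉ insert q₁ n)
    (hrec : ∀ (v₁ v₂ : HeightOneSpectrum (𝓞 K)), ((q₁ : ℕ) : 𝓞 K) ∈ v₁.asIdeal → ((q₂ : ℕ) : 𝓞 K) ∈ v₂.asIdeal →
      (κ n ∈ (W.baseChange K).torsionLocalKer (v₁.adicCompletion K) ((p ^ 1 : ℕ) : ℤ) ↔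
        κ (insert q₂ (insert q₁ n)) ∈ (W.baseChange K).torsionLocalKer (v₂.adicCompletion K) ((p ^ 1 : ℕ) : ℤ)))
    {μ μ'' : Bool} (hmem : κ n ∈ SelQP W K p c n μ)
    (hmem'' : κ (insert q₂ (insert q₁ n)) ∈ SelQP W K p c (insert q₂ (insert q₁ n)) μ'')
    (htrue : SelQP W K p c (insert q₁ n) true = ⊥) (hfalse : SelQP W K p c (insert q₁ n) false = ⊥) :
    κ n ≠ 0 ↔ κ (insert q₂ (insert q₁ n)) ≠ 0 :=
  CoreGraph.ne_zero_iff_of_rung (SelQP W K p c)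
    (fun (q : AdmQ W K p) (y : Vp W K p) ↦ ∀ v : HeightOneSpectrum (𝓞 K), ((q : ℕ) : 𝓞 K) ∈ v.asIdeal →
      y ∈ (W.baseChange K).torsionLocalKer (v.adicCompletion K) ((p ^ 1 : ℕ) : ℤ)) κ
    (fun _ _ _ _ hqn hy hT ↦ mem_selQP_insert_of_forall_mem_torsionLocalKer W K p c hqn hy hT)
    (fun _ _ _ _ _ hz hT ↦ mem_selQP_of_mem_selQP_insert_of_forall_mem_torsionLocalKer W K p c hz hT)
    (fun _ _ _ ↦ zero_mem _) hq₁ hq₂ (forall_mem_torsionLocalKer_iff_of_congr W K p hrec) hmem hmem'' htrue hfalse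

/-- **Propagation along rungs for level-indexed classes**: GIVEN (SRL) from every even bottom level and `κ(n) ∈ Sel_n^{some
sign}` at every even level, a non-zero class at ONE even level `n₀` forces `κ(n) ≠ 0` at every level `n` rung-connected to
`n₀` (`Relation.EqvGen` of «`b = a ∪ {q₁,q₂}` through an odd CORE level `a ∪ q₁`», inline). This is `baseCase` wherever the
component of `n₀` reaches — from ONE ignition instead of an anchor at every level. [cite: WZhang2014, Thm. 4.3, Thm. 7.2, §9]
[cite: Howard2006Bipartite, Cor. 2.4.12, Thm. 2.5.1] -/
theorem ne_zero_of_coreRungs (κ : Finset (AdmQ W K p) → Vp W K p)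
    (hrec : ∀ (n : Finset (AdmQ W K p)) (q₁ q₂ : AdmQ W K p), q₁ ∉ n → q₂ ∉ insert q₁ n → Even n.card →
      ∀ (v₁ v₂ : HeightOneSpectrum (𝓞 K)), ((q₁ : ℕ) : 𝓞 K) ∈ v₁.asIdeal → ((q₂ : ℕ) : 𝓞 K) ∈ v₂.asIdeal →
      (κ n ∈ (W.baseChange K).torsionLocalKer (v₁.adicCompletion K) ((p ^ 1 : ℕ) : ℤ) ↔
        κ (insert q₂ (insert q₁ n)) ∈ (W.baseChange K).torsionLocalKer (v₂.adicCompletion K) ((p ^ 1 : ℕ) : ℤ)))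
    (hmem : ∀ n : Finset (AdmQ W K p), Even n.card → ∃ μ, κ n ∈ SelQP W K p c n μ)
    {n₀ n : Finset (AdmQ W K p)} (hn₀ : Even n₀.card) (h0 : κ n₀ ≠ 0)
    (hpath : Relation.EqvGen (fun a b : Finset (AdmQ W K p) ↦ ∃ q₁ q₂, q₁ ∉ a ∧ q₂ ∉ insert q₁ a ∧
        b = insert q₂ (insert q₁ a) ∧ SelQP W K p c (insert q₁ a) true = ⊥ ∧ SelQP W K p c (insert q₁ a) false = ⊥)
      n₀ n) :
    Even n.card ∧ κ n ≠ 0 :=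
  CoreGraph.ne_zero_of_eqvGen_rung (SelQP W K p c)
    (fun (q : AdmQ W K p) (y : Vp W K p) ↦ ∀ v : HeightOneSpectrum (𝓞 K), ((q : ℕ) : 𝓞 K) ∈ v.asIdeal →
      y ∈ (W.baseChange K).torsionLocalKer (v.adicCompletion K) ((p ^ 1 : ℕ) : ℤ)) κ
    (fun _ _ _ _ hqn hy hT ↦ mem_selQP_insert_of_forall_mem_torsionLocalKer W K p c hqn hy hT)
    (fun _ _ _ _ _ hz hT ↦ mem_selQP_of_mem_selQP_insert_of_forall_mem_torsionLocalKer W K p c hz hT)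
    (fun _ _ _ ↦ zero_mem _)
    (fun n q₁ q₂ hq₁ hq₂ hn ↦ forall_mem_torsionLocalKer_iff_of_congr W K p (hrec n q₁ q₂ hq₁ hq₂ hn)) hmem hn₀ h0 hpath

/-! ### §2b The bipartite form (values at odd levels, laws (A), (B) two-sided): Howard's full core graph -/

/-- **Propagation along Howard's core graph for level-indexed classes and odd-level values.** Data: classes `κ n ∈ H¹(K, E[p])`
(even levels), value predicates `Λ n'` (odd levels, «`λ(n')` is a unit»), the TWO-SIDED laws (A) «`κ(n)` detected above a new
`q` ⟺ `Λ(n ∪ q)`» (`n` even) and (B) «`κ(n' ∪ q)` detected above the level prime `q` ⟺ `Λ(n')`» (`n'` odd) — Bertolini–Darmon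
Thms 4.2 ∕ 4.1 as equalities up to units — and `κ(n) ∈ Sel_n^{some sign}` at even levels. THEN from ONE seed (a non-zero class
at an even `n₀`, or a unit value at an odd `n₀`), `κ(n) ≠ 0` at every EVEN level `n` connected to `n₀` through core edges
(`Relation.EqvGen` of «`b = a ∪ {q}`, the odd end core», inline). [cite: Howard2006Bipartite, Cor. 2.3.5, Prop. 2.4.11,
Cor. 2.4.12, Thm. 2.5.1] [cite: BertoliniDarmon2005, Thm. 4.1, Thm. 4.2] [cite: WZhang2014, Thm. 7.2] -/
theorem ne_zero_of_coreEdges (κ : Finset (AdmQ W K p) → Vp W K p) (Λ : Finset (AdmQ W K p) → Prop)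
    (lawA : ∀ (n : Finset (AdmQ W K p)) (q : AdmQ W K p), Even n.card → q ∉ n →
      ((∃ v : HeightOneSpectrum (𝓞 K), ((q : ℕ) : 𝓞 K) ∈ v.asIdeal ∧
        κ n ∉ (W.baseChange K).torsionLocalKer (v.adicCompletion K) ((p ^ 1 : ℕ) : ℤ)) ↔ Λ (insert q n)))
    (lawB : ∀ (n' : Finset (AdmQ W K p)) (q : AdmQ W K p), Odd n'.card → q ∉ n' →
      ((∃ v : HeightOneSpectrum (𝓞 K), ((q : ℕ) : 𝓞 K) ∈ v.asIdeal ∧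
        κ (insert q n') ∉ (W.baseChange K).torsionLocalKer (v.adicCompletion K) ((p ^ 1 : ℕ) : ℤ)) ↔ Λ n'))
    (hmem : ∀ n : Finset (AdmQ W K p), Even n.card → ∃ μ, κ n ∈ SelQP W K p c n μ)
    {n₀ n : Finset (AdmQ W K p)} (seed : (Even n₀.card ∧ κ n₀ ≠ 0) ∨ (Odd n₀.card ∧ Λ n₀)) (hn : Even n.card)
    (hpath : Relation.EqvGen (fun a b : Finset (AdmQ W K p) ↦ ∃ q, q ∉ a ∧ b = insert q a ∧
        (Even a.card → SelQP W K p c (insert q a) true = ⊥ ∧ SelQP W K p c (insert q a) false = ⊥) ∧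
        (Odd a.card → SelQP W K p c a true = ⊥ ∧ SelQP W K p c a false = ⊥)) n₀ n) :
    κ n ≠ 0 := by
  have hIn : ∀ (n : Finset (AdmQ W K p)) (q : AdmQ W K p) (μ : Bool) (y : Vp W K p), q ∉ n → y ∈ SelQP W K p c n μ →
      (∀ v : HeightOneSpectrum (𝓞 K), ((q : ℕ) : 𝓞 K) ∈ v.asIdeal →
        y ∈ (W.baseChange K).torsionLocalKer (v.adicCompletion K) ((p ^ 1 : ℕ) : ℤ)) →
      y ∈ SelQP W K p c (insert q n) μ :=
    fun _ _ _ _ hqn hy hT ↦ mem_selQP_insert_of_forall_mem_torsionLocalKer W K p c hqn hy hT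
  have hOut : ∀ (n : Finset (AdmQ W K p)) (q : AdmQ W K p) (μ : Bool) (z : Vp W K p), q ∉ n →
      z ∈ SelQP W K p c (insert q n) μ →
      (∀ v : HeightOneSpectrum (𝓞 K), ((q : ℕ) : 𝓞 K) ∈ v.asIdeal →
        z ∈ (W.baseChange K).torsionLocalKer (v.adicCompletion K) ((p ^ 1 : ℕ) : ℤ)) →
      z ∈ SelQP W K p c n μ :=
    fun _ _ _ _ _ hz hT ↦ mem_selQP_of_mem_selQP_insert_of_forall_mem_torsionLocalKer W K p c hz hT
  have lawA' : ∀ (n : Finset (AdmQ W K p)) (q : AdmQ W K p), Even n.card → q ∉ n →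
      ((¬ ∀ v : HeightOneSpectrum (𝓞 K), ((q : ℕ) : 𝓞 K) ∈ v.asIdeal →
        κ n ∈ (W.baseChange K).torsionLocalKer (v.adicCompletion K) ((p ^ 1 : ℕ) : ℤ)) ↔ Λ (insert q n)) :=
    fun n q hn hqn ↦ (not_forall_mem_torsionLocalKer_iff W K p).trans (lawA n q hn hqn)
  have lawB' : ∀ (n' : Finset (AdmQ W K p)) (q : AdmQ W K p), Odd n'.card → q ∉ n' →
      ((¬ ∀ v : HeightOneSpectrum (𝓞 K), ((q : ℕ) : 𝓞 K) ∈ v.asIdeal →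
        κ (insert q n') ∈ (W.baseChange K).torsionLocalKer (v.adicCompletion K) ((p ^ 1 : ℕ) : ℤ)) ↔ Λ n') :=
    fun n' q hn' hqn' ↦ (not_forall_mem_torsionLocalKer_iff W K p).trans (lawB n' q hn' hqn')
  rcases seed with ⟨hn₀, h0⟩ | ⟨hn₀, h0⟩
  · exact CoreGraph.ne_zero_of_eqvGen (SelQP W K p c)
      (fun (q : AdmQ W K p) (y : Vp W K p) ↦ ∀ v : HeightOneSpectrum (𝓞 K), ((q : ℕ) : 𝓞 K) ∈ v.asIdeal →
        y ∈ (W.baseChange K).torsionLocalKer (v.adicCompletion K) ((p ^ 1 : ℕ) : ℤ))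
      κ Λ hIn hOut (fun _ _ _ ↦ zero_mem _) lawA' lawB' hmem hn₀ h0 hn hpath
  · exact CoreGraph.ne_zero_of_eqvGen_of_value (SelQP W K p c)
      (fun (q : AdmQ W K p) (y : Vp W K p) ↦ ∀ v : HeightOneSpectrum (𝓞 K), ((q : ℕ) : 𝓞 K) ∈ v.asIdeal →
        y ∈ (W.baseChange K).torsionLocalKer (v.adicCompletion K) ((p ^ 1 : ℕ) : ℤ))
      κ Λ hIn hOut (fun _ _ _ ↦ zero_mem _) lawA' lawB' hmem hn₀ h0 hn hpath


/-! ## §4 Supply at a ♯ additive frame: above every rank-one even level there is an odd CORE level ((A1), landed) -/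

section Supply

variable [W.IsElliptic] [Fact p.Prime]

/-- **An odd CORE level above every even level of canonical rank one, from (A1)** (binder form = the landed shape of
`stub_rankLoweringAdditive`): if `dim Sel_n⁺ + dim Sel_n⁻ = 1` then for some NEW admissible `q₁ ∉ n` BOTH
`Sel_{n∪q₁}^± = 0` — (A1) kills the generator of the rank-one line with codimension one and leaves the other (zero) sign
unchanged. Hence, for every further admissible `q₂ ∉ n ∪ q₁`, `n — n ∪ {q₁, q₂}` is a RUNG of §2a and `n — n ∪ q₁` a core
edge of §2b: the first brick of CONNECTIVITY (Howard 2006, Lemma 2.4.9). [cite: WZhang2014, Prop. 5.4, Lemma 7.3, §9]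
[cite: Howard2006Bipartite, Lemma 2.4.9] -/
theorem exists_oddCore_above_of_rankOne
    (hA1 : ∀ (n : Finset (AdmQ W K p)) (μ : Bool) (x : Vp W K p), x ∈ SelQP W K p c n μ → x ≠ 0 →
      ∃ q : AdmQ W K p, q ∉ n ∧ x ∉ SelQP W K p c (insert q n) μ ∧
        SelQP W K p c (insert q n) μ ≤ SelQP W K p c n μ ∧
        finrank (ZMod p) (SelQP W K p c (insert q n) μ) + 1 = finrank (ZMod p) (SelQP W K p c n μ) ∧
        SelQP W K p c (insert q n) (!μ) = SelQP W K p c n (!μ))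
    {n : Finset (AdmQ W K p)}
    (h1 : finrank (ZMod p) (SelQP W K p c n true) + finrank (ZMod p) (SelQP W K p c n false) = 1) :
    ∃ q₁ : AdmQ W K p, q₁ ∉ n ∧ SelQP W K p c (insert q₁ n) true = ⊥ ∧ SelQP W K p c (insert q₁ n) false = ⊥ := by
  -- the sign `μ` carrying the line, the other sign trivial
  obtain ⟨μ, hμ1, hμ0⟩ : ∃ μ : Bool, finrank (ZMod p) (SelQP W K p c n μ) = 1 ∧
      finrank (ZMod p) (SelQP W K p c n (!μ)) = 0 := by
    rcases Nat.eq_zero_or_pos (finrank (ZMod p) (SelQP W K p c n true)) with h | h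
    · exact ⟨false, by omega, h⟩
    · exact ⟨true, by omega, by change finrank (ZMod p) (SelQP W K p c n false) = 0; omega⟩
  -- a generator `x` of the line
  obtain ⟨⟨x, hxmem⟩, hx0, -⟩ := finrank_eq_one_iff'.mp hμ1
  have hx0' : x ≠ 0 := fun h ↦ hx0 (Subtype.ext h)
  -- (A1): a new admissible `q₁` killing `x`; then both canonical spaces at level `n ∪ {q₁}` vanish
  obtain ⟨q₁, hq₁, -, -, hfin, hneg⟩ := hA1 n μ x hxmem hx0'
  haveI := finiteDimensional_selQP W K p c (insert q₁ n) μ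
  haveI := finiteDimensional_selQP W K p c n (!μ)
  have hμ' : SelQP W K p c (insert q₁ n) μ = ⊥ := Submodule.finrank_eq_zero.mp (by omega)
  have hneg' : SelQP W K p c (insert q₁ n) (!μ) = ⊥ := by
    rw [hneg]
    exact Submodule.finrank_eq_zero.mp hμ0
  refine ⟨q₁, hq₁, ?_, ?_⟩
  · cases μ
    · exact hneg'
    · exact hμ'
  · cases μ
    · exact hμ'
    · exact hneg'

variable [NeZero (W.conductorNorm ℤ)] (Dt : ModularParametrizationData W (W.conductorNorm ℤ)) (β : ℤ) (ι : K →+* ℂ)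

include ι in
/-- **At a ♯ ADDITIVE FRAME, every rank-one even level has rungs above it** ((A1) DISCHARGED by the landed
`stub_rankLoweringAdditive`, akr-p1 g2): for complex conjugation `c ≠ 1` and `dim Sel_n⁺ + dim Sel_n⁻ = 1`, some NEW
admissible `q₁ ∉ n` has `Sel_{n∪q₁}⁺ = Sel_{n∪q₁}⁻ = 0`; so a class system with `κ(n) ≠ 0` at such a level has
`κ(n ∪ {q₁, q₂}) ≠ 0` for EVERY further admissible `q₂` (§2a), and the connected component of `n` in Howard's core graph is
infinite. [cite: WZhang2014, Prop. 5.4, Lemma 7.3] [cite: BertoliniDarmon2005, Thm. 3.2] [cite: Howard2006Bipartite, Lemma 2.4.9] -/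
theorem exists_oddCore_above_of_rankOne_at_frame (h5 : 5 ≤ p) (hadd : Addv W p)
    (hsurj : W.HasSurjectiveModNGaloisRep p)
    (hsp : ∀ (ℓ : ℕ) [Fact ℓ.Prime], W.HasMultiplicativeReductionAtPrime ℓ →
      ¬ p ∣ padicValInt ℓ W.minimalDiscriminantInt)
    (htwo : ∃ (ℓ₁ ℓ₂ : ℕ) (_ : Fact ℓ₁.Prime) (_ : Fact ℓ₂.Prime), ℓ₁ ≠ ℓ₂ ∧
      W.HasMultiplicativeReductionAtPrime ℓ₁ ∧ W.HasMultiplicativeReductionAtPrime ℓ₂)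
    (htam : ¬ p ∣ W.tamagawaProduct) (hr : W.analyticRank = 1)
    (hK : IsImaginaryQuadratic K) (hodd : Odd (NumberField.discr K))
    (hH : SatisfiesHeegnerHypothesis (W.conductorNorm ℤ) K)
    (hL : (W.quadraticTwist (NumberField.discr K : ℚ)).entireLFunction 1 ≠ 0)
    (hβ : (4 * (W.conductorNorm ℤ : ℤ)) ∣ β ^ 2 - NumberField.discr K) (hcM : ¬ (p : ℤ) ∣ Dt.c) (hc1 : c ≠ 1)
    {n : Finset (AdmQ W K p)}
    (h1 : finrank (ZMod p) (SelQP W K p c n true) + finrank (ZMod p) (SelQP W K p c n false) = 1) :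
    ∃ q₁ : AdmQ W K p, q₁ ∉ n ∧ SelQP W K p c (insert q₁ n) true = ⊥ ∧ SelQP W K p c (insert q₁ n) false = ⊥ :=
  exists_oddCore_above_of_rankOne W K p c
    (stub_rankLoweringAdditive W p K Dt β ι h5 hadd hsurj hsp htwo htam hr hK hodd hH hL hβ hcM c hc1) h1

end Supply

end Summit.BirchSwinnertonDyer.BirchSwinnertonDyer.Theorems.AdditiveKoly

end
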